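import Literature.AnabelianGeometry.EtaleTheta.ContH1ConjAction
import Mathlib.Topology.Algebra.Group.Quotient
import Mathlib.GroupTheory.Index
import Mathlib.GroupTheory.OrderOfElement
import HarnessLib

/-!
# Continuous `H¹`: reduction of the coefficients modulo a normal subgroup `B ≤ A`
# (support file for [EtTh] §1–§2)

Generic homological algebra for the concrete continuous first cohomology `ContH1 φ A H` of
`ContH1.lean` (seat abc-iut-L2-t1): functoriality in the COEFFICIENTS along the QUOTIENT map
`G' ↠ G'/B` for a normal subgroup `B` of `G'` contained in the abelian normal `A` — the passage
`H¹(−, A) → H¹(−, A/B)` ([cite: NeukirchSchmidtWingberg2008, I §2 and II §7] functoriality of `H¹` in the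
module; in [EtTh] §2 the passage from `Δ_Θ`- to `Δ_Θ/l·Δ_Θ`-coefficients, Def. 2.7 p. 41 "`η̲̈^Θ ∈
H¹(Π^tp_Ÿ̲̲, l·Δ_Θ)`", used by abc-iut-L2-t7's assembly of the choice `X̲̲` from the `Π^tp_X̲`-invariance of
`η̈^Θ` MODULO `l`-th powers).  Complement of abc-iut-w4-d014's `ContH1CoeffChange.lean` (coefficient change
along an INCLUSION `A ≤ A'`).  Contents:

* the coefficient group `A.map (QuotientGroup.mk' B) ≤ G'/B` with its `Normal` / `IsMulCommutative`
  instances, the action being conjugation through `(QuotientGroup.mk' B).comp φ`;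
* `reduceCocycle`, `reduce` — the maps on cocycles and on `H¹`; `reduce_mk`, `res_reduce`, `conj_reduce`;
  `reduceCocycle_apply_eq_iff` (values agree mod `B`);
* `pow_eq_one_of_pow_mem` — if every `a ∈ A` has `a^l ∈ B` then `H¹(H, A/B)` has exponent `l`
  (so "invariance modulo `l`-th powers" upstairs IS invariance downstairs);
* `discreteTopology_map_mk_of_isOpen` — if `B` is (relatively) OPEN in `A` then `A/B ⊆ G'/B` is DISCRETE,
  and `continuous_lift_of_discrete` / `exists_section` — any continuous map into `A/B` lifts along any section
  to a map into `A` that is continuous (the set-theoretic lift used to produce `Δ_Θ`-valued mod-`l` cocycles).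

Classical; no anabelian content; nothing of [EtTh] is asserted.  Seat abc-iut-w5-d234 (wave-5 prover), generic
sub-lemmas OFFERED to abc-iut-L2-t7 g2 (x1 assembly).
-/

noncomputable section

namespace Literature.AnabelianGeometry.EtaleTheta

namespace ContH1

open scoped IsMulCommutative

variable {G G' : Type*} [Group G] [TopologicalSpace G]
  [Group G'] [TopologicalSpace G'] [IsTopologicalGroup G']
  (φ : G →* G') (A B : Subgroup G') [A.Normal] [IsMulCommutative A] [B.Normal]
  (H : Subgroup G)

/-! ### The reduced coefficients `A/B ⊆ G'/B` -/

/-- The image `A·B/B ≅ A/(A ∩ B)` of `A` in `G'/B` is normal (`G' → G'/B` is onto).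
[cite: NeukirchSchmidtWingberg2008, I §2 and II §7] -/
instance normal_map_mk' : (A.map (QuotientGroup.mk' B)).Normal :=
  Subgroup.Normal.map inferInstance _ (QuotientGroup.mk'_surjective B)

omit [TopologicalSpace G'] [IsTopologicalGroup G'] [IsMulCommutative A] in
/-- Conjugation commutes with the reduction map (both computed in `G'`, resp. `G'/B`).
[cite: NeukirchSchmidtWingberg2008, I §2 and II §7] -/
theorem coe_mk'_conjNormal (g : G') (a : ↥A) :
    (QuotientGroup.mk' B ((MulAut.conjNormal g a : ↥A) : G') : G' ⧸ B) =
      (((MulAut.conjNormal (QuotientGroup.mk' B g))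
          (⟨QuotientGroup.mk' B (a : G'), Subgroup.mem_map_of_mem _ a.2⟩ : ↥(A.map (QuotientGroup.mk' B))) :
            ↥(A.map (QuotientGroup.mk' B))) : G' ⧸ B) := by
  simp only [MulAut.conjNormal_apply, map_mul, map_inv]

/-! ### Reduction on cocycles and on `H¹` -/

/-- **Reduction of coefficients on cocycles**: `f ↦ (A → A/B) ∘ f`, a continuous cocycle for the
conjugation action through `(G' → G'/B) ∘ φ`. [cite: NeukirchSchmidtWingberg2008, I §2 and II §7] -/
def reduceCocycle :
    contCocycles φ A H →* contCocycles ((QuotientGroup.mk' B).comp φ) (A.map (QuotientGroup.mk' B)) H where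
  toFun f := ⟨fun h => ⟨QuotientGroup.mk' B ((f.1 h : ↥A) : G'), Subgroup.mem_map_of_mem _ (f.1 h).2⟩,
    ((QuotientGroup.continuous_mk.comp (continuous_subtype_val.comp f.2.1)).subtype_mk _),
    fun g h => by
      apply Subtype.ext
      change (QuotientGroup.mk' B ((f.1 (g * h) : ↥A) : G') : G' ⧸ B) = _
      rw [f.2.2 g h, Subgroup.coe_mul, map_mul, Subgroup.coe_mul, coe_mk'_conjNormal]
      rfl⟩
  map_one' := Subtype.ext (funext fun _ => Subtype.ext (by simp))
  map_mul' f g := Subtype.ext (funext fun _ => Subtype.ext (by simp))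

/-- Values of the reduced cocycle. [cite: NeukirchSchmidtWingberg2008, I §2 and II §7] -/
@[simp] theorem reduceCocycle_apply_coe (f : contCocycles φ A H) (h : ↥H) :
    (((reduceCocycle φ A B H f).1 h : ↥(A.map (QuotientGroup.mk' B))) : G' ⧸ B) =
      QuotientGroup.mk' B ((f.1 h : ↥A) : G') := rfl

/-- Two cocycles have the same reduction at `h` iff their values agree modulo `B`.
[cite: NeukirchSchmidtWingberg2008, I §2 and II §7] -/
theorem reduceCocycle_apply_eq_iff (f f' : contCocycles φ A H) (h : ↥H) :
    (reduceCocycle φ A B H f).1 h = (reduceCocycle φ A B H f').1 h ↔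
      ((f.1 h : ↥A) : G')⁻¹ * ((f'.1 h : ↥A) : G') ∈ B := by
  rw [← Subtype.coe_inj, reduceCocycle_apply_coe, reduceCocycle_apply_coe, QuotientGroup.mk'_apply,
    QuotientGroup.mk'_apply, QuotientGroup.eq]

/-- **Reduction of coefficients** `H¹(H, A) → H¹(H, A/B)` (coboundaries go to coboundaries:
`∂a ↦ ∂ā`). [cite: NeukirchSchmidtWingberg2008, I §2 and II §7] -/
def reduce : ContH1 φ A H →* ContH1 ((QuotientGroup.mk' B).comp φ) (A.map (QuotientGroup.mk' B)) H :=
  QuotientGroup.map _ _ (reduceCocycle φ A B H) (by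
    intro f hf
    obtain ⟨a, ha⟩ := (mem_contCoboundaries_iff _).mp (Subgroup.mem_subgroupOf.mp hf)
    refine Subgroup.mem_subgroupOf.mpr ((mem_contCoboundaries_iff _).mpr
      ⟨⟨QuotientGroup.mk' B (a : G'), Subgroup.mem_map_of_mem _ a.2⟩, ?_⟩)
    funext x
    have hx := congrFun ha x
    apply Subtype.ext
    change (QuotientGroup.mk' B ((f.1 x : ↥A) : G') : G' ⧸ B) = _
    rw [hx, Subgroup.coe_mul, map_mul, Subgroup.coe_inv, map_inv, coe_mk'_conjNormal]
    rfl)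

/-- `reduce` on the class of a cocycle. [cite: NeukirchSchmidtWingberg2008, I §2 and II §7] -/
theorem reduce_mk (f : contCocycles φ A H) :
    reduce φ A B H (QuotientGroup.mk f) = QuotientGroup.mk (reduceCocycle φ A B H f) := rfl

/-- Reduction commutes with restriction. [cite: NeukirchSchmidtWingberg2008, I §2 and II §7] -/
theorem res_reduce {H₁ H₂ : Subgroup G} (hle : H₁ ≤ H₂) (x : ContH1 φ A H₂) :
    ContH1.res ((QuotientGroup.mk' B).comp φ) (A.map (QuotientGroup.mk' B)) hle (reduce φ A B H₂ x) =
      reduce φ A B H₁ (ContH1.res φ A hle x) := by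
  induction x using QuotientGroup.induction_on with
  | H f => rfl

/-- Reduction commutes with the conjugation action (for `H` normal in `G`).
[cite: NeukirchSchmidtWingberg2008, I §2 and II §7] -/
theorem conj_reduce [IsTopologicalGroup G] [H.Normal] (σ : G) (x : ContH1 φ A H) :
    ContH1.conj ((QuotientGroup.mk' B).comp φ) (A.map (QuotientGroup.mk' B)) σ (reduce φ A B H x) =
      reduce φ A B H (ContH1.conj φ A σ x) := by
  induction x using QuotientGroup.induction_on with
  | H f =>
    change (QuotientGroup.mk (conjCocycle _ _ σ (reduceCocycle φ A B H f)) : ContH1 _ _ H) =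
      QuotientGroup.mk (reduceCocycle φ A B H (conjCocycle φ A σ f))
    congr 1

/-! ### Exponent: invariance modulo `l`-th powers upstairs is invariance downstairs -/

/-- If every `a ∈ A` has `a^l ∈ B`, then `H¹(H, A/B)` is killed by `l`: `x^l = 1`.
[cite: NeukirchSchmidtWingberg2008, I §2 and II §7] -/
theorem pow_eq_one_of_pow_mem {l : ℕ} (hl : ∀ a ∈ A, a ^ l ∈ B)
    (x : ContH1 ((QuotientGroup.mk' B).comp φ) (A.map (QuotientGroup.mk' B)) H) : x ^ l = 1 := by
  induction x using QuotientGroup.induction_on with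
  | H F =>
    have hF : F ^ l = 1 := by
      apply Subtype.ext
      funext h
      apply Subtype.ext
      obtain ⟨a, ha, hFa⟩ := (F.1 h).2
      change ((((F ^ l).1 h) : ↥(A.map (QuotientGroup.mk' B))) : G' ⧸ B) = 1
      rw [SubgroupClass.coe_pow, Pi.pow_apply, SubgroupClass.coe_pow, ← hFa, ← map_pow,
        QuotientGroup.mk'_apply, QuotientGroup.eq_one_iff]
      exact hl a ha
    -- the class map as a homomorphism into `ContH1`
    let mkH : contCocycles ((QuotientGroup.mk' B).comp φ) (A.map (QuotientGroup.mk' B)) H →*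
        ContH1 ((QuotientGroup.mk' B).comp φ) (A.map (QuotientGroup.mk' B)) H :=
      { toFun := fun c => (QuotientGroup.mk c : _), map_one' := rfl, map_mul' := fun _ _ => rfl }
    change mkH F ^ l = 1
    rw [← map_pow, hF, map_one]

/-- Hence: if `t·x = x · (reduce y)^l`-type invariance holds upstairs modulo `l`-th powers, i.e.
`conj t x = x * y ^ l` in `H¹(H, A)`, then `reduce x` is honestly `t`-invariant in `H¹(H, A/B)`.
[cite: NeukirchSchmidtWingberg2008, I §2 and II §7] -/
theorem conj_reduce_eq_of_conj_eq_mul_pow [IsTopologicalGroup G] [H.Normal] {l : ℕ}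
    (hl : ∀ a ∈ A, a ^ l ∈ B) (t : G) (x y : ContH1 φ A H) (h : ContH1.conj φ A t x = x * y ^ l) :
    ContH1.conj ((QuotientGroup.mk' B).comp φ) (A.map (QuotientGroup.mk' B)) t (reduce φ A B H x) =
      reduce φ A B H x := by
  rw [conj_reduce, h, map_mul, map_pow, pow_eq_one_of_pow_mem φ A B H hl, mul_one]

/-! ### Discreteness of `A/B` when `B` is open in `A`, and continuous lifts -/

omit [A.Normal] [IsMulCommutative A] in
/-- If `B` is OPEN in `A` (relatively: the trace on `A` of an open subset of `G'`), then the image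
`A/B ⊆ G'/B` is DISCRETE for the subspace topology of the quotient topology. [folklore]-level topology;
[cite: NeukirchSchmidtWingberg2008, I §2 and II §7] -/
theorem discreteTopology_map_mk_of_isOpen (hBA : B ≤ A)
    (hB : IsOpen ((B.subgroupOf A : Subgroup ↥A) : Set ↥A)) :
    DiscreteTopology ↥(A.map (QuotientGroup.mk' B)) := by
  -- an open `W ⊆ G'` with `W ∩ A = B`
  obtain ⟨W, hW, hWB⟩ := isOpen_induced_iff.mp hB
  -- the saturated open `W · B`, still meeting `A` in `B`
  have hsat : ∀ w ∈ W, ∀ b ∈ B, w * b ∈ A → w * b ∈ B := by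
    intro w hw b hb hwb
    have hwA : w ∈ A := by simpa using A.mul_mem hwb (A.inv_mem (hBA hb))
    have : (⟨w, hwA⟩ : ↥A) ∈ Subtype.val ⁻¹' W := hw
    rw [hWB] at this
    exact B.mul_mem this hb
  apply discreteTopology_of_isOpen_singleton_one
  -- `{1} = (π '' W) ∩ (A/B)` inside `A/B`
  have hopen : IsOpen ((QuotientGroup.mk' B) '' W) := QuotientGroup.isOpenMap_coe W hW
  refine ⟨(QuotientGroup.mk' B) '' W, hopen, ?_⟩
  ext ⟨y, hy⟩
  simp only [Set.mem_preimage, Set.mem_image, Set.mem_singleton_iff]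
  constructor
  · rintro ⟨w, hw, hwy⟩
    obtain ⟨a, ha, hay⟩ := hy
    apply Subtype.ext
    change y = 1
    -- `π w = π a` with `a ∈ A` forces `w ∈ A`, hence `w ∈ W ∩ A = B`
    have hwa : a⁻¹ * w ∈ B := by
      rw [← QuotientGroup.eq, ← QuotientGroup.mk'_apply, ← QuotientGroup.mk'_apply, hay, hwy]
    have hwB : w ∈ B := by
      have h1 := hsat w hw (w⁻¹ * a * (a⁻¹ * w) * 1) (by
        simp) (by
        have : w * (w⁻¹ * a * (a⁻¹ * w) * 1) = w := by group
        rw [this]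
        simpa using A.mul_mem ha (hBA hwa))
      simpa using h1
    rw [← hwy, QuotientGroup.mk'_apply, QuotientGroup.eq_one_iff]
    exact hwB
  · intro h1
    have hy1 : y = 1 := congrArg Subtype.val h1
    have h1W : (1 : G') ∈ W := by
      have : (⟨1, A.one_mem⟩ : ↥A) ∈ Subtype.val ⁻¹' W := by rw [hWB]; exact B.one_mem
      exact this
    exact ⟨1, h1W, by rw [hy1, map_one]⟩

omit [TopologicalSpace G'] [IsTopologicalGroup G'] [A.Normal] [IsMulCommutative A] in
/-- A set-theoretic SECTION of `A → A/B` exists. [folklore]-level; [cite: NeukirchSchmidtWingberg2008, I §2 and II §7] -/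
theorem exists_section :
    ∃ s : ↥(A.map (QuotientGroup.mk' B)) → ↥A, ∀ y, QuotientGroup.mk' B ((s y : ↥A) : G') = (y : G' ⧸ B) := by
  classical
  refine ⟨fun y => ⟨(Subgroup.mem_map.mp y.2).choose, (Subgroup.mem_map.mp y.2).choose_spec.1⟩,
    fun y => (Subgroup.mem_map.mp y.2).choose_spec.2⟩

omit [IsTopologicalGroup G'] [A.Normal] [IsMulCommutative A] in
/-- Any map into a DISCRETE `A/B` composed with any section is continuous: the continuous lift of a
mod-`B` cocycle to an `A`-valued function. [folklore]-level; [cite: NeukirchSchmidtWingberg2008, I §2 and II §7] -/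
theorem continuous_lift_of_discrete {X : Type*} [TopologicalSpace X]
    [DiscreteTopology ↥(A.map (QuotientGroup.mk' B))]
    (F : X → ↥(A.map (QuotientGroup.mk' B))) (hF : Continuous F) (s : ↥(A.map (QuotientGroup.mk' B)) → ↥A) :
    Continuous (s ∘ F) :=
  continuous_of_discreteTopology.comp hF

/-! ### Size of `A/B` and bijectivity of `x ↦ x^n` for `n` prime to it -/

omit [TopologicalSpace G'] [IsTopologicalGroup G'] [A.Normal] [IsMulCommutative A] in
/-- `|A/B| = [A : A ∩ B]` (as `Nat.card`; `0` if infinite). [cite: NeukirchSchmidtWingberg2008, I §2 and II §7] -/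
theorem natCard_map_mk'_eq_index :
    Nat.card ↥(A.map (QuotientGroup.mk' B)) = (B.subgroupOf A).index := by
  have hrange : ((QuotientGroup.mk' B).comp A.subtype).range = A.map (QuotientGroup.mk' B) := by
    rw [MonoidHom.range_comp, Subgroup.range_subtype]
  have hker : ((QuotientGroup.mk' B).comp A.subtype).ker = B.subgroupOf A := by
    rw [← MonoidHom.comap_ker, QuotientGroup.ker_mk']
    rfl
  rw [← hrange, ← hker, Subgroup.index_ker]

omit [TopologicalSpace G'] [IsTopologicalGroup G'] [A.Normal] [IsMulCommutative A] in
/-- If `n` is prime to `[A : A ∩ B]` (e.g. `A/B` of odd order `l` and `n = 2`, the [EtTh] §2 use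
`Δ_Θ/l·Δ_Θ`), then `x ↦ x^n` is BIJECTIVE on `A/B` (Mathlib `powCoprime`).
[cite: NeukirchSchmidtWingberg2008, I §2 and II §7] -/
theorem pow_bijective_map_mk'_of_coprime {n : ℕ} (h : ((B.subgroupOf A).index).Coprime n) :
    Function.Bijective fun a : ↥(A.map (QuotientGroup.mk' B)) => a ^ n := by
  rw [← natCard_map_mk'_eq_index] at h
  have he : (fun a : ↥(A.map (QuotientGroup.mk' B)) => a ^ n) = powCoprime h :=
    funext fun a => (powCoprime_apply h a).symm
  rw [he]
  exact (powCoprime h).bijective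

end ContH1

end Literature.AnabelianGeometry.EtaleTheta

end
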